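import Literature.AlgebraicGeometry.HodgeTheory.HodgeStructureOfHodgeModelTypeShift
import Literature.AlgebraicGeometry.HodgeTheory.HodgeRiemannPolarizabilityProofs
import Literature.AlgebraicGeometry.HodgeTheory.HodgeFiltrationModelsReductionProofs
import Literature.AlgebraicGeometry.HodgeTheory.ComplexConjugationHolds
import Literature.AlgebraicGeometry.HodgeTheory.RationalLattice
import Literature.AlgebraicGeometry.Motives.HodgeStructureLifting
import Literature.AlgebraicGeometry.Motives.HodgeStructureDirectSum
import Literature.AlgebraicGeometry.Motives.HodgeStructureProofs
import HarnessLib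

/-!
# Ring 2 · sub-cell AbelianAll (ALL ABELIAN VARIETIES), André axis, part X-a — the Hodge-theoretic
# PSEUDO-INVERSE: a rational morphism of bidegree `(r, r)` between the cohomologies of smooth
# projective varieties has a rational quasi-inverse of bidegree `(−r, −r)` (semisimplicity of
# polarisable Hodge structures, on the tree's carriers)

HONEST FRAMING (page 1, verbatim): **research route, not a corollary; conditional on HC_CM plus one named
minimal statement.** Cell line: research route conditional on HC_CM; not a corollary; Q11.4-sentence-2
already refuted in dim ≥ 3. Nothing in this file proves a case of the Hodge conjecture; no node of the cell
occurs here. Seat `pub-hodge-ring2-ab-andre-2`, gen 3; this is the linear-algebra engine of part X-b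
(`Ring2AbelianAllAndreFibreClassOnPath`: the ON-PATH lemma `HodgeConjecture ⟹ (β∀′)` for the repaired
fibre-class Lefschetz nodes, owed item o6 of RING2-MAP §AbelianAll AA2.9/AA2.14 and LEAD ruling L13.3 (i)).

## Content (everything PROVED; no definition, no named fact, no hypothesis of the cell)

* §0–§1 the internal direct sum `V_ℂ = ⊕ₚ V^{p,n−p}` of an abstract `ℚ`-Hodge structure (Deligne 1.2.5 =
  the tree's `iSupIndep_piece_holds` / `iSup_piece_eq_top_holds`) and its piece projectors (inside the proof
  of `baseChange_projection_mem_piece`); `exists_hom_projection` — **the projection onto a sub-Hodge structure along a complementary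
  sub-Hodge structure is an endomorphism of Hodge structures** (Voisin I Lemma 7.26 / Voisin 2025
  Prop. 2.11 give the complement; that the resulting idempotent respects the Hodge decomposition is the
  routine check written out here on the tree's filtration-form structures).
* §2 `exists_hom_pseudoInverse` — **in the semisimple category of polarisable `ℚ`-Hodge structures every
  morphism `L : H₁ → H₂` has a quasi-inverse `T : H₂ → H₁` with `L T L = L`** ("The category of
  polarizable rational Hodge structures is semi-simple", Voisin 2025 Prop. 2.11; von Neumann regularity
  of semisimple abelian categories): `T` lifts the projection onto `im L` through `L` by the tree's
  `Hom.exists_comp_eq_of_range_le`.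
* §3 `exists_typeShift_pseudoInverse` — the CARRIER form used by part X-b: for smooth projective `X`, `Y`
  of dimensions `n`, `m` and a `ℂ`-linear `L : Hᵃ(X(ℂ); ℂ) → Hᵇ(Y(ℂ); ℂ)`, `b = a + 2r`, mapping rational
  classes to rational classes and Hodge type `(p, q)` to `(p + r, q + r)` (a morphism `Hᵃ(X) → Hᵇ(Y)(r)`,
  e.g. a Gysin map composed with a pull-back), there is a `ℂ`-linear `T : Hᵇ(Y(ℂ); ℂ) → Hᵃ(X(ℂ); ℂ)`
  mapping rational classes to rational classes, type `(p', q')` to type `(p' − r, q' − r)` when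
  `p', q' ≥ r` and to `0` otherwise, with `L T L = L`. These are exactly the hypotheses `hφ`, `hφH`,
  `hφ0` of the tree's `isAlgebraicCorrespondence_of_hodgeConjectureFor_prod` (Voisin I Lemma 11.41 in
  every bidegree + `HC(Y × X)`), so under the Hodge conjecture for `X × Y` such a `T` is an ALGEBRAIC
  correspondence.

References: Voisin2025 (Prop. 2.11, Cor. 2.12); VoisinHodgeI2002 (§7.1.1, §7.3.1 Def. 7.22–7.24,
Lemma 7.26, §7.3.2, §11.3.3 Lemma 11.41); DeligneHodgeII1971 (1.2.5, 2.1.13–2.1.15, Thm. 2.3.5).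
-/

noncomputable section

set_option linter.dupNamespace false

open scoped TensorProduct
open CategoryTheory AlgebraicGeometry
open Literature.AlgebraicGeometry Literature.AlgebraicGeometry.Motives
open Literature.AlgebraicGeometry.HodgeTheory
open Literature.AlgebraicTopology.SingularHomology (singularCohomology)

namespace Summit.HodgeConjecture.HodgeConjecture.Ring2.AbelianAll

/-! ## §0 The Hodge decomposition as an internal direct sum -/

section Abstract

universe u v

variable {V : Type u} [AddCommGroup V] [Module ℚ V]
variable {W : Type v} [AddCommGroup W] [Module ℚ W]
variable {n : ℤ}

open Motives.HodgeStructure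

/-- The Hodge decomposition `V_ℂ = ⊕ₚ V^{p,n−p}` of a `ℚ`-Hodge structure as an internal direct sum
(Deligne, Hodge II, 1.2.5; the tree's `iSupIndep_piece_holds`, `iSup_piece_eq_top_holds`).
[cite: DeligneHodgeII1971, 1.2.5] -/
theorem isInternal_piece (H : Motives.HodgeStructure V n) :
    DirectSum.IsInternal fun p : ℤ ↦ H.piece p (n - p) :=
  DirectSum.isInternal_submodule_of_iSupIndep_of_iSup_eq_top (iSupIndep_piece_holds H)
    (iSup_piece_eq_top_holds H)

/-! ## §1 The projection onto a sub-Hodge structure along a complementary one is a morphism -/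

/-- The complexified projection is the identity on `S_ℂ`. [folklore] -/
theorem baseChange_projection_of_mem_left {S S' : Submodule ℚ V} (h : IsCompl S S') {y : ℂ ⊗[ℚ] V}
    (hy : y ∈ S.baseChange ℂ) : (S.projection S' h).baseChange ℂ y = y := by
  rw [Submodule.baseChange_eq_span] at hy
  induction hy using Submodule.span_induction with
  | mem z hz =>
    obtain ⟨s, hs, rfl⟩ := hz
    rw [TensorProduct.mk_apply, LinearMap.baseChange_tmul, Submodule.projection_apply_of_mem_left h hs]
  | zero => rw [map_zero]
  | add z₁ z₂ _ _ h₁ h₂ => rw [map_add, h₁, h₂]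
  | smul c z _ hz => rw [map_smul, hz]

/-- The complexified projection vanishes on `S'_ℂ`. [folklore] -/
theorem baseChange_projection_of_mem_right {S S' : Submodule ℚ V} (h : IsCompl S S') {y : ℂ ⊗[ℚ] V}
    (hy : y ∈ S'.baseChange ℂ) : (S.projection S' h).baseChange ℂ y = 0 := by
  rw [Submodule.baseChange_eq_span] at hy
  induction hy using Submodule.span_induction with
  | mem z hz =>
    obtain ⟨s, hs, rfl⟩ := hz
    rw [TensorProduct.mk_apply, LinearMap.baseChange_tmul, Submodule.projection_apply_of_mem_right h hs,
      TensorProduct.tmul_zero]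
  | zero => rw [map_zero]
  | add z₁ z₂ _ _ h₁ h₂ => rw [map_add, h₁, h₂, add_zero]
  | smul c z _ hz => rw [map_smul, hz, smul_zero]

/-- The complexified projection lands in `S_ℂ`. [folklore] -/
theorem baseChange_projection_mem_left {S S' : Submodule ℚ V} (h : IsCompl S S') (x : ℂ ⊗[ℚ] V) :
    (S.projection S' h).baseChange ℂ x ∈ S.baseChange ℂ := by
  have hr : (S.projection S' h).baseChange ℂ x ∈ LinearMap.range ((S.projection S' h).baseChange ℂ) :=
    LinearMap.mem_range_self _ x
  rwa [range_baseChange, Submodule.range_projection] at hr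

/-- `x − e_ℂ x` lies in `S'_ℂ` for the projection `e` onto `S` along `S'`. [folklore] -/
theorem sub_baseChange_projection_mem_right {S S' : Submodule ℚ V} (h : IsCompl S S') (x : ℂ ⊗[ℚ] V) :
    x - (S.projection S' h).baseChange ℂ x ∈ S'.baseChange ℂ := by
  induction x using TensorProduct.induction_on with
  | zero =>
    rw [map_zero, sub_zero]
    exact Submodule.zero_mem _
  | tmul c v =>
    rw [LinearMap.baseChange_tmul, ← TensorProduct.tmul_sub]
    exact Submodule.tmul_mem_baseChange_of_mem c (Submodule.sub_projection_mem h v)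
  | add x y hx hy =>
    rw [map_add, add_sub_add_comm]
    exact Submodule.add_mem _ hx hy

/-- **The projection onto a sub-Hodge structure `S` along a complementary sub-Hodge structure `S'`
respects the Hodge decomposition**: for `x ∈ V^{p,n−p}` write `x = a + b`, `a = e_ℂ x ∈ S_ℂ`,
`b ∈ S'_ℂ`; the Hodge components `aᵢ ∈ S_ℂ`, `bᵢ ∈ S'_ℂ` (Def. 7.24) satisfy `aᵢ + bᵢ = xᵢ = 0` for
`i ≠ p`, so `aᵢ ∈ S_ℂ ∩ S'_ℂ = 0` and `a = a_p ∈ V^{p,n−p}`. [cite: VoisinHodgeI2002, §7.3.1 Def. 7.24 and Lemma 7.26] -/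
theorem baseChange_projection_mem_piece {H : Motives.HodgeStructure V n} (S S' : SubHodgeStructure H)
    (h : IsCompl S.toSubmodule S'.toSubmodule) {p : ℤ} {x : ℂ ⊗[ℚ] V} (hx : x ∈ H.piece p (n - p)) :
    (S.toSubmodule.projection S'.toSubmodule h).baseChange ℂ x ∈ H.piece p (n - p) := by
  classical
  -- the Hodge-piece projectors `π i` of the internal direct sum `V_ℂ = ⊕ V^{i,n-i}`
  set E := LinearEquiv.ofBijective (DirectSum.coeLinearMap fun i : ℤ ↦ H.piece i (n - i))
    (isInternal_piece H) with hE
  let π : ℤ → ℂ ⊗[ℚ] V →ₗ[ℂ] ℂ ⊗[ℚ] V := fun i ↦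
    (H.piece i (n - i)).subtype ∘ₗ DirectSum.component ℂ ℤ (fun i : ℤ ↦ H.piece i (n - i)) i ∘ₗ
      E.symm.toLinearMap
  have hπ : ∀ i y, π i y = ((E.symm y) i : ℂ ⊗[ℚ] V) := fun _ _ ↦ rfl
  have hπmem : ∀ i y, π i y ∈ H.piece i (n - i) := fun i y ↦ by
    rw [hπ]
    exact Submodule.coe_mem _
  have hπid : ∀ {i} {y}, y ∈ H.piece i (n - i) → π i y = y := fun {i y} hy ↦ by
    rw [hπ, (isInternal_piece H).ofBijective_coeLinearMap_of_mem hy]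
  have hπne : ∀ {i j} {y}, j ≠ i → y ∈ H.piece j (n - j) → π i y = 0 := fun {i j y} hji hy ↦ by
    rw [hπ, (isInternal_piece H).ofBijective_coeLinearMap_of_mem_ne hji hy, Submodule.coe_zero]
  have hπzero : ∀ {y}, (∀ i, π i y = 0) → y = 0 := fun {y} hy ↦ by
    have h0 : E.symm y = 0 := DFinsupp.ext fun i ↦ Subtype.ext (hy i)
    rw [← E.apply_symm_apply y, h0, map_zero]
  -- the components of a vector of a sub-Hodge structure lie in it (Def. 7.24)
  have hπsub : ∀ (T : SubHodgeStructure H) {y}, y ∈ T.toSubmodule.baseChange ℂ →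
      ∀ i, π i y ∈ T.toSubmodule.baseChange ℂ := by
    intro T y hy i
    have hy' := T.baseChange_le_iSup_inf hy
    clear hy
    induction hy' using Submodule.iSup_induction' with
    | mem j y hy =>
      obtain ⟨hyT, hyj⟩ := hy
      by_cases hji : j = i
      · subst hji
        rw [hπid hyj]
        exact hyT
      · rw [hπne hji hyj]
        exact Submodule.zero_mem _
    | zero =>
      rw [map_zero]
      exact Submodule.zero_mem _
    | add y₁ y₂ _ _ h₁ h₂ =>
      rw [map_add]
      exact Submodule.add_mem _ h₁ h₂
  -- `x = a + (x - a)`, `a = e_ℂ x ∈ S_ℂ`, `x - a ∈ S'_ℂ`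
  set e := (S.toSubmodule.projection S'.toSubmodule h).baseChange ℂ with he
  set a := e x with ha
  have haS : a ∈ S.toSubmodule.baseChange ℂ := baseChange_projection_mem_left h x
  have hbS' : x - a ∈ S'.toSubmodule.baseChange ℂ := sub_baseChange_projection_mem_right h x
  -- the components of `a` off `p` vanish
  have hcomp : ∀ i, i ≠ p → π i a = 0 := by
    intro i hip
    have hxi : π i x = 0 := hπne (Ne.symm hip) hx
    have hai : π i a ∈ S.toSubmodule.baseChange ℂ := hπsub S haS i
    have hbi : π i (x - a) ∈ S'.toSubmodule.baseChange ℂ := hπsub S' hbS' i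
    have hab : π i a = -π i (x - a) := by
      rw [map_sub, hxi, zero_sub, neg_neg]
    have h1 : e (π i a) = π i a := baseChange_projection_of_mem_left h hai
    have h2 : e (π i a) = 0 := by
      rw [hab, map_neg, baseChange_projection_of_mem_right h hbi, neg_zero]
    rw [← h1, h2]
  -- hence `a` is its own `p`-component
  have hap : a = π p a := by
    rw [← sub_eq_zero]
    refine hπzero fun i ↦ ?_
    rw [map_sub]
    by_cases hip : i = p
    · subst hip
      rw [hπid (hπmem i a), sub_self]
    · rw [hcomp i hip, hπne (Ne.symm hip) (hπmem p a), sub_zero]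
  rw [hap]
  exact hπmem p a

/-- **The projection onto a sub-Hodge structure along a complementary sub-Hodge structure is an
endomorphism of Hodge structures** (`Hom.exists_of_mapPieceLe` fed with `baseChange_projection_mem_piece`).
[cite: VoisinHodgeI2002, §7.3.1 Def. 7.22–7.24 and Lemma 7.26] [cite: Voisin2025, Prop. 2.11] -/
theorem exists_hom_projection {H : Motives.HodgeStructure V n} (S S' : SubHodgeStructure H)
    (h : IsCompl S.toSubmodule S'.toSubmodule) :
    ∃ e : Hom H H, e.toLinearMap = S.toSubmodule.projection S'.toSubmodule h := by
  refine Hom.exists_of_mapPieceLe H H _ fun p q hpq ↦ ?_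
  obtain rfl : q = n - p := by omega
  rintro _ ⟨x, hx, rfl⟩
  exact baseChange_projection_mem_piece S S' h hx

/-! ## §2 Quasi-inverses in the semisimple category of polarisable Hodge structures -/

/-- **Every morphism `L : H₁ → H₂` of finite-dimensional polarisable `ℚ`-Hodge structures (of one
weight) has a quasi-inverse `T : H₂ → H₁` with `L ∘ T ∘ L = L`** — semisimplicity of the category of
polarisable Hodge structures (Voisin 2025 Prop. 2.11 / Voisin I Lemma 7.26): the image `im L` is a
sub-Hodge structure with a complementary sub-Hodge structure `D`, the projection `e` onto `im L` along
`D` is a morphism (§1), and `e` lifts through `L` (`Hom.exists_comp_eq_of_range_le`, `H₁` polarisable):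
`L ∘ T = e`, whence `L T L = e L = L`. [cite: Voisin2025, Prop. 2.11 and Cor. 2.12]
[cite: VoisinHodgeI2002, §7.3.1 Lemma 7.26] [cite: DeligneHodgeII1971, Thm. 2.3.5] -/
theorem exists_hom_pseudoInverse [Module.Finite ℚ V] [Module.Finite ℚ W] {H₁ : Motives.HodgeStructure V n}
    {H₂ : Motives.HodgeStructure W n} (h₁ : H₁.IsPolarizable) (h₂ : H₂.IsPolarizable) (L : Hom H₁ H₂) :
    ∃ T : Hom H₂ H₁, ∀ v, L.toLinearMap (T.toLinearMap (L.toLinearMap v)) = L.toLinearMap v := by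
  obtain ⟨R, hR⟩ := L.exists_subHodgeStructure_range
  obtain ⟨D, hD⟩ := R.exists_isCompl h₂
  obtain ⟨e, he⟩ := exists_hom_projection R D hD
  have hle : LinearMap.range e.toLinearMap ≤ LinearMap.range L.toLinearMap := by
    rw [he, Submodule.range_projection, hR]
  obtain ⟨T, hT⟩ := L.exists_comp_eq_of_range_le h₁ e hle
  refine ⟨T, fun v ↦ ?_⟩
  have h := congrArg (fun φ : Hom H₂ H₂ ↦ φ.toLinearMap (L.toLinearMap v)) hT
  simp only [Hom.comp_toLinearMap', LinearMap.comp_apply] at h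
  rw [h, he]
  exact Submodule.projection_apply_of_mem_left hD (by rw [hR]; exact LinearMap.mem_range_self _ v)

end Abstract

/-! ## §3 Carrier form: rational maps of bidegree `(r, r)` between cohomologies of smooth projective
varieties have rational quasi-inverses of bidegree `(−r, −r)` -/

section Carriers

variable {m n : ℕ} {Y X : SchemeOver ℂ}

/-- **Quasi-inverse of a rational bidegree-`(r, r)` map on the carriers.** Let `X`, `Y` be smooth
projective of dimensions `n`, `m`, `b = a + 2r`, and `L : Hᵃ(X(ℂ); ℂ) → Hᵇ(Y(ℂ); ℂ)` `ℂ`-linear, mapping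
rational classes to rational classes and classes of Hodge type `(p, q)` to classes of type
`(p + r, q + r)` (a morphism of Hodge structures `Hᵃ(X) → Hᵇ(Y)(r)`, Voisin I Def. 7.22 — e.g. a Gysin
morphism followed by a pull-back). Then there is a `ℂ`-linear `T : Hᵇ(Y(ℂ); ℂ) → Hᵃ(X(ℂ); ℂ)` which maps
rational classes to rational classes, classes of type `(p', q')` to classes of type `(p' − r, q' − r)`
when `p', q' ≥ r` and to `0` when `p' < r` or `q' < r`, and satisfies `L ∘ T ∘ L = L`. Proof: the
Hodge structures of real Hodge models (`HodgeModel.hodgeStructure`, polarisable by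
`smoothProjective_hodgeStructure_isPolarizable_holds`), `L` as a morphism onto the Tate twist
(`HodgeModel.exists_hom_of_typeShift`), its quasi-inverse (§2), read back on the carriers through
`β : Hᵏ(–(ℂ); ℚ) ⊗ ℂ ≃ Hᵏ(–(ℂ); ℂ)`. [cite: Voisin2025, Prop. 2.11] [cite: VoisinHodgeI2002, §7.3.1 Def. 7.22 and §7.3.2]
[cite: DeligneHodgeII1971, 2.1.13–2.1.15] -/
theorem exists_typeShift_pseudoInverse (hX : IsSmoothProjective n X) (hY : IsSmoothProjective m Y)
    {a b r : ℕ} (hab : a + 2 * r = b) (L : complexBetti X a →ₗ[ℂ] complexBetti Y b)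
    (hL : ∀ c, IsRationalClass c → IsRationalClass (L c))
    (hLH : ∀ (p q : ℕ), p + q = a → ∀ c, IsOfHodgeType n X a p q c →
      IsOfHodgeType m Y b (p + r) (q + r) (L c)) :
    ∃ T : complexBetti Y b →ₗ[ℂ] complexBetti X a,
      (∀ c, IsRationalClass c → IsRationalClass (T c)) ∧
      (∀ (p' q' : ℕ), p' + q' = b → ∀ c, IsOfHodgeType m Y b p' q' c →
        ∀ (p q : ℕ), p + r = p' → q + r = q' → IsOfHodgeType n X a p q (T c)) ∧
      (∀ (p' q' : ℕ), p' + q' = b → ∀ c, IsOfHodgeType m Y b p' q' c → (p' < r ∨ q' < r) → T c = 0) ∧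
      ∀ c, L (T (L c)) = L c := by
  classical
  have hI := hodgePQ_independent_of_hodgeModel_holds
  obtain ⟨A, hAr⟩ := exists_isReal_hodgeModel_holds n X hX
  obtain ⟨B, hBr⟩ := exists_isReal_hodgeModel_holds m Y hY
  have hA := hAr.isHodgeSymmetric
  have hB := hBr.isHodgeSymmetric
  haveI := finite_singularCohomology_rat_complexPoints hX a
  haveI := finite_singularCohomology_rat_complexPoints hY b
  have hw : ((b : ℕ) : ℤ) - 2 * (r : ℤ) = ((a : ℕ) : ℤ) := by omega
  set H₁ := A.hodgeStructure hX hA a with hH₁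
  set H₂ := B.hodgeStructure hY hB b with hH₂
  set H₂' := (H₂.tateTwist r).cast hw with hH₂'
  have hT : ∀ p q : ℤ, H₂'.piece p q = H₂.piece (p + r) (q + r) :=
    HodgeModel.piece_tateTwist_cast hY B hB hw
  have hpiece₁ : ∀ {p q : ℕ}, p + q = a → H₁.piece p q = A.ratPiece hX a p q := fun hpq ↦
    A.piece_eq_ratPiece hX hA hpq
  have hpiece₂ : ∀ {p q : ℕ}, p + q = b → H₂.piece p q = B.ratPiece hY b p q := fun hpq ↦
    B.piece_eq_ratPiece hY hB hpq
  have hF₁ : ∀ s : ℤ, H₁.F s = A.ratF hX a s := fun s ↦ rfl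
  -- `L` as a morphism `H₁ → H₂(r)`
  obtain ⟨Lq, hLq⟩ := HodgeModel.exists_hom_of_typeShift hX hY A hA B hB hab H₂' hT L hL
    (fun p q hpq c hc ↦ (hI.isOfHodgeType_iff hY B).1
      (hLH p q hpq c ((hI.isOfHodgeType_iff hX A).2 hc)))
  -- polarisability and the quasi-inverse
  have h₁ : H₁.IsPolarizable := smoothProjective_hodgeStructure_isPolarizable_holds hX A hA a
  have h₂ : H₂'.IsPolarizable :=
    ((smoothProjective_hodgeStructure_isPolarizable_holds hY B hB b).tateTwist r).cast hw
  obtain ⟨Tq, hTq⟩ := exists_hom_pseudoInverse h₁ h₂ Lq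
  -- the carrier of `Tq`
  set βX := ofRatClassBaseChangeEquiv hX a with hβX
  set βY := ofRatClassBaseChangeEquiv hY b with hβY
  set T : complexBetti Y b →ₗ[ℂ] complexBetti X a :=
    βX.toLinearMap ∘ₗ Tq.toLinearMap.baseChange ℂ ∘ₗ βY.symm.toLinearMap with hTdef
  have hTc : ∀ y, ofRatClassBaseChange (ComplexPoints X) a (Tq.toLinearMap.baseChange ℂ y) =
      T (ofRatClassBaseChange (ComplexPoints Y) b y) := by
    intro y
    rw [hTdef, LinearMap.comp_apply, LinearMap.comp_apply, ← ofRatClassBaseChangeEquiv_apply hY b,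
      LinearEquiv.coe_toLinearMap, LinearEquiv.coe_toLinearMap, LinearEquiv.symm_apply_apply,
      ofRatClassBaseChangeEquiv_apply]
  have hβYs := ofRatClassBaseChange_surjective hY b
  have hβXs := ofRatClassBaseChange_surjective hX a
  refine ⟨T, ?_, ?_, ?_, ?_⟩
  · -- rational classes go to rational classes
    intro c hc
    obtain ⟨v, rfl⟩ := (isRationalClass_iff_mem_range_ofRatClass c).1 hc
    rw [← ofRatClassBaseChange_ofRat, ← hTc, Motives.HodgeStructure.baseChange_ofRat,
      ofRatClassBaseChange_ofRat]
    exact isRationalClass_ofRatClass _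
  · -- types `(p', q')` with `p', q' ≥ r` go to `(p' - r, q' - r)`
    intro p' q' hpq' c hc p q hp hq
    obtain ⟨y, rfl⟩ := hβYs c
    have hy : y ∈ H₂'.piece p q := by
      rw [hT, show ((p : ℤ) + r) = ((p' : ℕ) : ℤ) by omega, show ((q : ℤ) + r) = ((q' : ℕ) : ℤ) by omega,
        hpiece₂ hpq', HodgeModel.mem_ratPiece_iff, HodgeModel.complexification_apply]
      exact (hI.isOfHodgeType_iff hY B).1 hc
    have hTy := Tq.map_piece_le p q ⟨y, hy, rfl⟩
    rw [hpiece₁ (show p + q = a by omega), HodgeModel.mem_ratPiece_iff,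
      HodgeModel.complexification_apply, hTc] at hTy
    exact ⟨A, hTy⟩
  · -- types with no target are killed
    intro p' q' hpq' c hc hlt
    obtain ⟨y, rfl⟩ := hβYs c
    have hy : y ∈ H₂'.piece ((p' : ℤ) - r) ((q' : ℤ) - r) := by
      rw [hT, show ((p' : ℤ) - r + r) = ((p' : ℕ) : ℤ) by ring,
        show ((q' : ℤ) - r + r) = ((q' : ℕ) : ℤ) by ring,
        hpiece₂ hpq', HodgeModel.mem_ratPiece_iff, HodgeModel.complexification_apply]
      exact (hI.isOfHodgeType_iff hY B).1 hc
    have hTy := Tq.map_piece_le _ _ ⟨y, hy, rfl⟩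
    have hbot : H₁.piece ((p' : ℤ) - r) ((q' : ℤ) - r) = ⊥ := by
      rcases hlt with h | h
      · refine eq_bot_iff.2 ((Motives.HodgeStructure.piece_le_complexConj_F _ _ _).trans ?_)
        rw [hF₁, A.ratF_eq_bot hX a (by omega), Motives.HodgeStructure.complexConj_bot]
      · refine eq_bot_iff.2 ((Motives.HodgeStructure.piece_le_F _ _ _).trans ?_)
        rw [hF₁, A.ratF_eq_bot hX a (by omega)]
    rw [hbot, Submodule.mem_bot] at hTy
    rw [← hTc, hTy, map_zero]
  · -- `L T L = L`
    intro c
    obtain ⟨x, rfl⟩ := hβXs c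
    have key : Lq.toLinearMap ∘ₗ Tq.toLinearMap ∘ₗ Lq.toLinearMap = Lq.toLinearMap :=
      LinearMap.ext fun v ↦ hTq v
    have keyC : ∀ z, Lq.toLinearMap.baseChange ℂ (Tq.toLinearMap.baseChange ℂ (Lq.toLinearMap.baseChange ℂ z)) =
        Lq.toLinearMap.baseChange ℂ z := by
      intro z
      have h := congrArg (fun φ : _ →ₗ[ℚ] _ ↦ φ.baseChange ℂ z) key
      simpa only [LinearMap.baseChange_comp, LinearMap.comp_apply] using h
    rw [← hLq, ← hTc, ← hLq, keyC, hLq]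

end Carriers

end Summit.HodgeConjecture.HodgeConjecture.Ring2.AbelianAll

end
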